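import Literature.Computability.Complexity.MatchingSunflowers
import Literature.Combinatorics.SetFamily.BiasedMeasure
import Summits.PneNP.PneNP.Theorems.KarlinRubinMonotoneBlindCoverUpset

/-!
# Route NegLimited — R7-C2 `DeficientMass`: at bias `1/8` half of the mass sits on `|W| ≤ m/2` (rung F-N1/p3, line r7-crosscut)

Registered stub `stub_deficientMass` of the skeleton line `r7-crosscut` for item T5 =
`NegLimited.GapPerfectMatchingQuasipoly` (stmt-PneNP-19861; HOME/pnp-ideate-p3/Skeleton-R7-crosscut.lean,
sha 0079776e761d5a21). The statement `DeficientMass` is copied verbatim from the cell's shared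
definitions file (HOME/pnp-ideate-p3/turnkey-R8/NegLimitedGapPMDefs.lean) into the shared namespace
`Summit.PneNP.PneNP.Theorems.NegLimitedGapPM`: for the `1/8`-biased random vertex set `W` of the
`2m` vertices of `K_{m,m}`, `Pr[2|W| ≤ m] ≥ 1/2` (`m ≥ 1`). Proof: Markov's inequality
(`Literature.Combinatorics.SetFamily.mul_sum_biasedWeight_filter_lt_le` at threshold `m/2`) with the
mean size `E_{1/8}|W| = 2m/8 = m/4` (`MonotoneBlind.VertexCover.sum_biasedWeight_mul_card`), so
`Pr[|W| > m/2] ≤ 1/2`, and the complement via `sum_biasedWeight`. Role on the line: the cross-cut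
graph `crossGraph W` has matching number `≤ |W|`, hence is `K`-deficient for every `K ≥ 2` on this
event (`crossDeficient_holds` of the skeleton) — the negative test distribution of T5⁺ has mass `≥ 1/2`
on deficient graphs.
-/

set_option linter.dupNamespace false -- `Summit.PneNP.PneNP.…`: summit = sub-problem name (D-0017 single-conjunct layout)

namespace Summit.PneNP.PneNP.Theorems.NegLimitedGapPM

open Finset
open Literature.Computability.Complexity.PerfectMatching (Vtx)
open Literature.Combinatorics.SetFamily

/-- R7-C2: at bias `1/8`, at least half of the mass has `#W ≤ m/2` (statement verbatim from the
skeleton line `r7-crosscut`; proved below). -/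
def DeficientMass : Prop :=
  ∀ m : ℕ, 1 ≤ m →
    (1 / 2 : ℝ) ≤ ∑ W ∈ univ.filter (fun W : Finset (Vtx m) => 2 * #W ≤ m), biasedWeight (1 / 8) W

/-- **R7-C2 proved**: Markov at threshold `m/2` with `E_{1/8}|W| = m/4`. -/
theorem deficientMass_holds : DeficientMass := by
  intro m hm
  have hmr : (0 : ℝ) < m := by exact_mod_cast hm
  -- the complementary event, in the real form used by Markov's inequality
  have hcompl : (univ.filter fun W : Finset (Vtx m) => ¬ 2 * #W ≤ m) =
      univ.filter fun W : Finset (Vtx m) => (m : ℝ) / 2 < (#W : ℝ) := by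
    refine filter_congr fun W _ => ?_
    rw [not_le, div_lt_iff₀ (two_pos : (0 : ℝ) < 2), mul_comm]
    exact_mod_cast Iff.rfl
  -- total mass splits over the event and its complement
  have htot : ∑ W ∈ univ.filter (fun W : Finset (Vtx m) => 2 * #W ≤ m), biasedWeight (1 / 8) W +
      ∑ W ∈ univ.filter (fun W : Finset (Vtx m) => (m : ℝ) / 2 < (#W : ℝ)), biasedWeight (1 / 8) W
        = 1 := by
    rw [← hcompl, sum_filter_add_sum_filter_not, sum_biasedWeight]
  -- Markov: (m/2) · Pr[|W| > m/2] ≤ E|W| = (1/8) · 2m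
  have hmarkov := mul_sum_biasedWeight_filter_lt_le (α := Vtx m) (p := 1 / 8) (by norm_num)
    (by norm_num) ((m : ℝ) / 2) (fun W => (#W : ℝ)) fun W => Nat.cast_nonneg _
  rw [MonotoneBlind.VertexCover.sum_biasedWeight_mul_card] at hmarkov
  have hcard : (Fintype.card (Vtx m) : ℝ) = 2 * m := by
    rw [Fintype.card_sum, Fintype.card_fin]; push_cast; ring
  rw [hcard] at hmarkov
  -- hence Pr[|W| > m/2] ≤ 1/2
  have htail : ∑ W ∈ univ.filter (fun W : Finset (Vtx m) => (m : ℝ) / 2 < (#W : ℝ)),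
      biasedWeight (1 / 8) W ≤ 1 / 2 := by
    by_contra h
    rw [not_le] at h
    have : (m : ℝ) / 2 * (1 / 2) < (m : ℝ) / 2 *
        ∑ W ∈ univ.filter (fun W : Finset (Vtx m) => (m : ℝ) / 2 < (#W : ℝ)),
          biasedWeight (1 / 8) W := mul_lt_mul_of_pos_left h (by positivity)
    linarith
  linarith

/-- **Registered stub `stub_deficientMass` of line `r7-crosscut`** (item stmt-PneNP-19861,
skeleton sha 0079776e761d5a21): R7-C2 by name. -/
theorem stub_deficientMass : DeficientMass := deficientMass_holds

end Summit.PneNP.PneNP.Theorems.NegLimitedGapPM
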